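import Summits.Ventures.DiscreteObjects.PP12.OrderThirteenOmSoundPack
import Summits.Ventures.DiscreteObjects.PP12.OrderThirteenOmSoundWalk

/-!
# PP(12), order-13 cell: soundness of the kernel enumeration of doubly lexical orbit matrices, III — the search step on true data, SOUNDNESS of `search`, stitching of split runs and chunks
Framing: lottery ticket; floor = certified bounds/negative ranges.

Cell pub-namedobj (venture DiscreteObjects), target (M). Text: designs gen 21 (`OrderThirteenOmSearchSound`, verified rc 0 as one file); split into four modules `OrderThirteenOmSoundPack` / `…Walk` / `…Search` / `…First` by designs gen 22 for the gate's 400-line rule (declarations and proofs unchanged).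
Here: along the invariant `Inv` of a true matrix (`TrueMat`), one step of the search on the true row succeeds (`step_true`: column sums, completable columns, ties, partial
column Gram), hence `search_sound`; `GoodSt` from `search` (`goodSt_of_search`) and from split runs with literal ORACLE states (`goodSt_of_searchB`, `eq_of_eqSt`); chunked
expansions (`goodChunk_of_childrenN`, `goodChunk_append`, `goodSt_of_goodChunk`); lengths / drops of literal candidate lists (`unpackC_drop`). No `sorry`, no new axioms.
-/

set_option maxRecDepth 100000

namespace Summit.Ventures.DiscreteObjects.PP12

namespace Om13

open Finset Shape13

section truemat

variable {m : Fin 11 → Fin 11 → ℕ} (T : TrueMat m)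
include T

omit T in
/-- column partial sums as fields -/
theorem cs_succ_eq (d : ℕ) : ∑ s ∈ range d, (rowR (mN m s)).rv = pack (fun a => ∑ s ∈ range d, ext (mN m s) a) 11 := by
  simp_rw [rv_rowR]; exact sum_pack _ _ _

omit T in
/-- Gram partial sums as fields -/
theorem G_succ_eq (d : ℕ) : ∑ s ∈ range d, (rowR (mN m s)).g = pack (fun i => ∑ s ∈ range d, ext (mN m s) (i % 11) * ext (mN m s) (i / 11)) 121 := by
  simp_rw [g_rowR]; exact sum_pack _ _ _

/-- a full column sum over `ℕ`-indexed rows -/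
theorem sum_range11_ext (a : ℕ) (ha : a < 11) : ∑ s ∈ range 11, ext (mN m s) a = 12 := by
  rw [Finset.sum_range, ← T.col ⟨a, ha⟩]
  exact Finset.sum_congr rfl fun s _ => by rw [mN_of_lt m s.2, ext_of_lt _ ha]

/-- a full column Gram entry over `ℕ`-indexed rows -/
theorem sum_range11_ext_mul (a b : ℕ) (ha : a < 11) (hb : b < 11) :
    ∑ s ∈ range 11, ext (mN m s) a * ext (mN m s) b = if a = b then 24 else 12 := by
  rw [Finset.sum_range]
  have e : ∀ s : Fin 11, ext (mN m s) a * ext (mN m s) b = m s ⟨a, ha⟩ * m s ⟨b, hb⟩ := fun s => by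
    rw [mN_of_lt m s.2, ext_of_lt _ ha, ext_of_lt _ hb]
  simp_rw [e]
  split_ifs with hab
  · subst hab; exact T.colsq _
  · exact T.colx _ _ fun h => hab (by simpa using congrArg Fin.val h)

omit T in
/-- partial sums of nonnegative terms over an initial segment are bounded by the full sum -/
theorem sum_range_le_of_le {F : ℕ → ℕ} {d : ℕ} (hd : d ≤ 11) : ∑ s ∈ range d, F s ≤ ∑ s ∈ range 11, F s :=
  sum_le_sum_of_subset (range_subset_range.2 hd)

/-- **one step of the search on the true row succeeds and preserves the invariant** -/
theorem step_true {st : St} (hI : Inv m st) (hd : st.depth < 11) {rest : List Row} (hrest : (filt (rowR (m ⟨st.depth, hd⟩)) rest).Pairwise fun a b => b.v < a.v)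
    (hcomp : ∀ s : Fin 11, st.depth < s → rowR (m s) ∈ rest) :
    ∃ st', step st (rowR (m ⟨st.depth, hd⟩)) rest = some st' ∧ Inv m st' ∧ st'.depth = st.depth + 1 := by
  set d := st.depth with hdd
  set r := rowR (m ⟨d, hd⟩) with hr
  have hrN : rowR (mN m d) = r := by rw [mN_of_lt m hd]
  -- the new packed sums
  have hcs : st.cs + r.rv = ∑ s ∈ range (d + 1), (rowR (mN m s)).rv := by rw [sum_range_succ, hI.cs, hrN]
  have hG : st.G + r.g = ∑ s ∈ range (d + 1), (rowR (mN m s)).g := by rw [sum_range_succ, hI.G, hrN]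
  have c1 : colLeOK (st.cs + r.rv) = true := by
    rw [hcs, cs_succ_eq]
    exact colLeOK_pack fun a ha => by rw [← sum_range11_ext T a ha]; exact sum_range_le_of_le (by omega)
  have c2 : colDoneOK (st.cs + r.rv) (10 - d) = true := by
    rw [hcs, cs_succ_eq]
    refine colDoneOK_pack (fun a ha => by rw [← sum_range11_ext T a ha]; exact sum_range_le_of_le (by omega)) fun hl a ha => ?_
    have htot := sum_range11_ext T a ha
    rw [← sum_range_add_sum_Ico _ (show d + 1 ≤ 11 by omega)] at htot
    have hb : ∑ s ∈ Ico (d + 1) 11, ext (mN m s) a ≤ (10 - d) * 4 := by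
      have := Finset.sum_le_card_nsmul (Ico (d + 1) 11) (fun s => ext (mN m s) a) 4 fun s _ => by
        simp only [ext, mN]; split_ifs <;> first | exact T.le4 _ _ | exact Nat.zero_le _
      simpa using this
    omega
  have c3 : tieOK st.tied r.ge = true := tieOK_rowR fun k hk ht => T.cols k hk ⟨d, hd⟩ fun s hs => hI.tied k hk ht s hs
  have c4 : gramOK (st.G + r.g) = true := by
    rw [hG, G_succ_eq]
    refine gramOK_pack fun i hi => ?_
    have ha : i % 11 < 11 := Nat.mod_lt _ (by norm_num)
    have hb : i / 11 < 11 := by omega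
    rw [← sum_range11_ext_mul T _ _ ha hb]
    exact sum_range_le_of_le (by omega)
  refine ⟨⟨filt r rest, st.cs + r.rv, st.G + r.g, newTied st.tied r.gt, d + 1, r.v :: st.chosen⟩, ?_, ?_, rfl⟩
  · unfold step; rw [c1, c2, c3, c4]; rfl
  · exact {
      dle := by show d + 1 ≤ 11; omega
      chosen := by show r.v :: st.chosen = chosenOf m (d + 1); rw [chosenOf, hI.chosen, hrN]
      cs := hcs
      G := hG
      tied := by
        intro k hk ht s hs
        obtain ⟨ht0, hnlt⟩ := testBit_newTied ht
        change (s : ℕ) < d + 1 at hs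
        rcases Nat.lt_succ_iff_lt_or_eq.1 hs with hs | hs
        · exact hI.tied k hk ht0 s hs
        · have hsd : s = ⟨d, hd⟩ := Fin.ext hs
          subst hsd
          have hle := T.cols k hk ⟨d, hd⟩ fun s' hs' => hI.tied k hk ht0 s' hs'
          have := hnlt hk
          omega
      sorted := hrest
      complete := by
        intro s hs
        change d + 1 ≤ (s : ℕ) at hs
        refine mem_filt.2 ⟨hcomp s (by omega), ?_⟩
        exact ipOK_rowR (T.le4 _) (T.le4 _) (T.cross _ _ fun e => by have := congrArg Fin.val e; simp at this; omega) }

/-- **the inductive step**: if all children pass `k`, the child of the true row exists, satisfies the invariant, and passes `k` -/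
theorem children_true {k : St → Bool} {st : St} (hI : Inv m st) (hd : st.depth < 11) (h : children k st st.cands = true) :
    ∃ st', k st' = true ∧ Inv m st' ∧ st'.depth = st.depth + 1 := by
  obtain ⟨pre, rest, hsplit⟩ := List.append_of_mem (hI.complete ⟨st.depth, hd⟩ le_rfl)
  rw [hsplit] at h
  have hch := children_of_mem h
  have hsorted := hI.sorted
  rw [hsplit] at hsorted
  have hrest_sorted : rest.Pairwise fun a b => b.v < a.v := (List.pairwise_append.1 hsorted).2.1.of_cons
  obtain ⟨st', hstep, hI', hd'⟩ := step_true T hI hd ((hrest_sorted).sublist (filt_sublist _ _))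
    (fun s hs => mem_after_of_lt hsorted (by rw [← hsplit]; exact hI.complete s hs.le) (T.rows _ _ hs))
  rw [hstep] at hch
  exact ⟨st', hch, hI', hd'⟩

/-- **SOUNDNESS OF THE ENUMERATION**: along the invariant, a successful search lists the key of the true matrix -/
theorem search_sound (SOLS : List ℕ) : ∀ (f : ℕ) (st : St), Inv m st → st.depth + f = 11 → search SOLS f st = true → memKey (keyM m) SOLS = true
  | 0, st, hI, hf, h => by
    rw [search] at h
    rwa [hI.chosen, show st.depth = 11 by omega] at h
  | f + 1, st, hI, hf, h => by
    rw [search] at h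
    obtain ⟨st', h', hI', hd'⟩ := children_true T hI (by omega) h
    exact search_sound SOLS f st' hI' (by omega) h'

end truemat

/-- a full search from a state makes it good -/
theorem goodSt_of_search {SOLS : List ℕ} {st : St} {f : ℕ} (hf : st.depth + f = 11) (h : search SOLS f st = true) : GoodSt SOLS st :=
  fun _ T hI => search_sound T SOLS f st hI hf h

/-- `eqList` decides equality -/
theorem eq_of_eqList : ∀ {a b : List ℕ}, eqList a b = true → a = b
  | [], [], _ => rfl
  | [], _ :: _, h => by simp [eqList] at h
  | _ :: _, [], h => by simp [eqList] at h
  | x :: xs, y :: ys, h => by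
    simp only [eqList, Bool.and_eq_true, Shape13.beq_eq_decide, decide_eq_true_eq] at h
    rw [h.1, eq_of_eqList h.2]

/-- `eqRow` decides equality -/
theorem eq_of_eqRow {a b : Row} (h : eqRow a b = true) : a = b := by
  cases a; cases b
  simp only [eqRow, Bool.and_eq_true, Shape13.beq_eq_decide, decide_eq_true_eq] at h
  obtain ⟨⟨⟨⟨h1, h2⟩, h3⟩, h4⟩, h5⟩ := h
  subst h1 h2 h3 h4 h5; rfl

/-- `eqRows` decides equality -/
theorem eq_of_eqRows : ∀ {a b : List Row}, eqRows a b = true → a = b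
  | [], [], _ => rfl
  | [], _ :: _, h => by simp [eqRows] at h
  | _ :: _, [], h => by simp [eqRows] at h
  | x :: xs, y :: ys, h => by
    simp only [eqRows, Bool.and_eq_true] at h
    rw [eq_of_eqRow h.1, eq_of_eqRows h.2]

/-- `eqSt` decides equality -/
theorem eq_of_eqSt {a b : St} (h : eqSt a b = true) : a = b := by
  cases a; cases b
  simp only [eqSt, Bool.and_eq_true, Shape13.beq_eq_decide, decide_eq_true_eq] at h
  obtain ⟨⟨⟨⟨⟨h1, h2⟩, h3⟩, h4⟩, h5⟩, h6⟩ := h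
  subst h1 h2 h3 h4
  rw [eq_of_eqList h5, eq_of_eqRows h6]

/-- an oracle hit is a listed state -/
theorem mem_of_inOrc {st : St} : ∀ {orc : List St}, inOrc st orc = true → ∃ o ∈ orc, st = o
  | [], h => by simp [inOrc] at h
  | o :: os, h => by
    simp only [inOrc, Bool.or_eq_true] at h
    rcases h with h | h
    · exact ⟨o, List.mem_cons_self .., eq_of_eqSt h⟩
    · obtain ⟨o', ho', e⟩ := mem_of_inOrc h
      exact ⟨o', List.mem_cons_of_mem _ ho', e⟩

/-- **STITCHING**: a split run from a state, whose oracle states are all good, makes the state good -/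
theorem goodSt_of_searchB {SOLS : List ℕ} {orc : List St} (horc : ∀ o ∈ orc, GoodSt SOLS o) {f : ℕ} :
    ∀ (c : ℕ) (st : St), st.depth + c + f = 11 → searchB SOLS orc f c st = true → GoodSt SOLS st
  | 0, st, hcf, h => by
    rw [searchB, Bool.or_eq_true] at h
    rcases h with h | h
    · obtain ⟨o, ho, rfl⟩ := mem_of_inOrc h
      exact horc _ ho
    · exact goodSt_of_search (by omega) h
  | c + 1, st, hcf, h => by
    rw [searchB] at h
    intro m T hI
    obtain ⟨st', h', hI', hd'⟩ := children_true T hI (by omega) h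
    exact goodSt_of_searchB horc c st' (by omega) h' m T hI'

/-- building the list hypothesis of `goodSt_of_searchB` -/
theorem goodAll_cons {SOLS : List ℕ} {o : St} {os : List St} (ho : GoodSt SOLS o) (hos : ∀ o' ∈ os, GoodSt SOLS o') : ∀ o' ∈ o :: os, GoodSt SOLS o' := by
  intro o' h
  rcases List.mem_cons.1 h with rfl | h
  exacts [ho, hos o' h]

/-- the empty oracle -/
theorem goodAll_nil {SOLS : List ℕ} : ∀ o ∈ ([] : List St), GoodSt SOLS o := fun _ h => absurd h (by simp)

/-! ### chunked expansion of a node (separate kernel declarations over ranges of its candidate list) -/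

/-- `childrenN` over a list whose element `r` lies within the first `n`: the child of `r` (with everything after it) passes the continuation -/
theorem childrenN_of_mem {k : St → Bool} {st : St} {r : Row} {rest : List Row} :
    ∀ {pre : List Row} {n : ℕ}, pre.length < n → childrenN k st n (pre ++ r :: rest) = true → (match step st r rest with | none => true | some st' => k st') = true
  | [], 0, h, _ => absurd h (by simp)
  | [], n + 1, _, h => by simp only [List.nil_append, childrenN, Bool.and_eq_true] at h; exact h.1
  | x :: pre, 0, h, _ => absurd h (by simp)
  | x :: pre, n + 1, hn, h => by
    simp only [List.cons_append, childrenN, Bool.and_eq_true] at h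
    exact childrenN_of_mem (by simpa using hn) h.2

/-- **a chunk declaration makes its chunk good**: `childrenN` over the candidates from offset `a`, with a split continuation whose oracle states are good -/
theorem goodChunk_of_childrenN {SOLS : List ℕ} {orc : List St} (horc : ∀ o ∈ orc, GoodSt SOLS o) {st : St} {f a len : ℕ} (hf : st.depth + 1 + f = 11)
    {l : List Row} (hl : l = st.cands.drop a) (h : childrenN (searchB SOLS orc f 0) st len l = true) : GoodChunk SOLS st a len := by
  intro m T hI pre rest hd hsplit ha hlt
  subst hl
  rw [hsplit, List.drop_append_of_le_length ha] at h
  have hch := childrenN_of_mem (by rw [List.length_drop]; omega) h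
  have hsorted := hI.sorted
  rw [hsplit] at hsorted
  have hrest_sorted : rest.Pairwise fun a b => b.v < a.v := (List.pairwise_append.1 hsorted).2.1.of_cons
  obtain ⟨st', hstep, hI', hd'⟩ := step_true T hI hd ((hrest_sorted).sublist (filt_sublist _ _))
    (fun s hs => mem_after_of_lt hsorted (by rw [← hsplit]; exact hI.complete s hs.le) (T.rows _ _ hs))
  rw [hstep] at hch
  exact goodSt_of_searchB horc 0 st' (by omega) hch m T hI'

/-- consecutive good chunks merge -/
theorem goodChunk_append {SOLS : List ℕ} {st : St} {a l1 l2 : ℕ} (h1 : GoodChunk SOLS st a l1) (h2 : GoodChunk SOLS st (a + l1) l2) : GoodChunk SOLS st a (l1 + l2) := by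
  intro m T hI pre rest hd hsplit ha hlt
  by_cases h : pre.length < a + l1
  · exact h1 m T hI pre rest hd hsplit ha h
  · exact h2 m T hI pre rest hd hsplit (by omega) (by omega)

/-- a good chunk from `0` covering the whole candidate list makes the state good -/
theorem goodSt_of_goodChunk {SOLS : List ℕ} {st : St} {L : ℕ} (h : GoodChunk SOLS st 0 L) (hL : st.cands.length ≤ L) (hd : st.depth < 11) : GoodSt SOLS st := by
  intro m T hI
  obtain ⟨pre, rest, hsplit⟩ := List.append_of_mem (hI.complete ⟨st.depth, hd⟩ le_rfl)
  have : pre.length < st.cands.length := by rw [hsplit, List.length_append, List.length_cons]; omega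
  exact h m T hI pre rest hd hsplit (Nat.zero_le _) (by omega)

/-- the length of an unpacked chunk -/
theorem unpackW_length (n K : ℕ) : (unpackW n K).length = n := by
  induction n generalizing K with
  | zero => rfl
  | succ n ih => rw [unpackW, List.length_cons, ih]

/-- the length of a chunked literal list is at most `n` -/
theorem valsW_length_le : ∀ (n : ℕ) (Ks : List ℕ), (valsW n Ks).length ≤ n
  | n, [] => by simp [valsW]
  | n, K :: Ks => by
    rw [valsW, List.length_append, unpackW_length]
    have := valsW_length_le (n - 64) Ks
    omega

/-- the length of a literal candidate list is at most `n` -/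
theorem unpackC_length_le (n : ℕ) (Ks : List ℕ) : (unpackC n Ks).length ≤ n := by
  unfold unpackC; rw [List.length_map]; exact valsW_length_le n Ks

/-- dropping whole chunks of a literal candidate list -/
theorem unpackC_drop (n j : ℕ) (Ks : List ℕ) (h : 64 * j ≤ n) : (unpackC n Ks).drop (64 * j) = unpackC (n - 64 * j) (Ks.drop j) := by
  unfold unpackC
  rw [← List.map_drop]
  congr 1
  induction j generalizing n Ks with
  | zero => simp
  | succ j ih =>
    cases Ks with
    | nil => simp [valsW]
    | cons K Ks =>
      have hlen : (unpackW (min n 64) K).length = 64 := by rw [unpackW_length]; omega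
      rw [valsW, show 64 * (j + 1) = 64 + 64 * j by ring, ← List.drop_drop, List.drop_left' hlen, ih (n - 64) Ks (by omega), List.drop_succ_cons]
      congr 1; omega

/-- dropping to an arbitrary offset of a literal candidate list: whole chunks, then the rest -/
theorem unpackC_drop2 (n j e : ℕ) (Ks : List ℕ) (h : 64 * j ≤ n) : (unpackC n Ks).drop (64 * j + e) = (unpackC (n - 64 * j) (Ks.drop j)).drop e := by
  rw [← List.drop_drop, unpackC_drop n j Ks h]

end Om13

end Summit.Ventures.DiscreteObjects.PP12
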